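import Summits.KontsevichZagierPeriods.KontsevichZagierPeriods.Theorems.MzvKernelInKZ.Negative.HalfAngle

/-!
# `MzvKernelInKZ` (stmt-KontsevichZagierPeriods-3914): negative side — `Q² ≡ 2·[P₂]`: dissection of the square and the reflected Calabi triangle

Companion of `Negative/HalfAngle.lean`.  `Q² ≡ 2·[cell t₀ < t₁]` by one domain additivity with
disjoint pieces, one coordinate swap and a null diagonal (`of_G2_sub_two_LT_mem`); the Calabi
triangle `P₂ = {u₀ + u₁ < π/2} = {t₀ + t₁ + t₀t₁ < 1}` is carried onto that cell by the reflection of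
the second coordinate, ONE change-of-variables move (`Trirep_sub_LTrep_mem_cov`); hence
`Q² ≡ 2·[P₂, g⊗g]` (`of_G2_sub_two_Trirep_mem`).

Sources: F. Beukers, J. A. C. Kolk, E. Calabi, *Sums of generalized harmonic series and volumes*, Nieuw Arch. Wisk. (4) 11 (1993), 217–224; M. Kontsevich, D. Zagier, *Periods* (2001), §1.2 (rules (1a), (2)).
-/

noncomputable section

namespace Summit.KontsevichZagierPeriods.MzvKernelInKZ.Negative

open Set MeasureTheory MvPolynomial
open Literature.NumberTheory.Transcendental
open Literature.ModelTheory.ExponentialFields (IsSemialgebraic)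

/-! ### `Q² ≡ 2 · [cell t₀ < t₁]` (one dissection, one swap, one null diagonal) -/

/-- The two order cells of the square. [folklore] -/
def cellLT : Set (Fin 2 → ℝ) := G2.domain ∩ {z | z 0 < z 1}
/-- The order cell `{t₁ < t₀}` of the square. [folklore] -/
def cellGT : Set (Fin 2 → ℝ) := G2.domain ∩ {z | z 1 < z 0}

/-- `lt2` is `ℚ`-semialgebraic. [folklore] -/
theorem isSemialgebraic_lt2 (i j : Fin 2) : IsSemialgebraic ℚ {z : Fin 2 → ℝ | z j < z i} := by
  convert Literature.ModelTheory.ExponentialFields.isSemialgebraic_setOf_eval_pos (R := ℝ)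
    (X i - X j : MvPolynomial (Fin 2) ℚ) using 1
  ext z; simp [sub_pos]

/-- `cellLT` lies in the ambient domain. [folklore] -/
theorem cellLT_sub : cellLT ⊆ G2.domain := inter_subset_left
/-- `cellGT` lies in the ambient domain. [folklore] -/
theorem cellGT_sub' : cellGT ⊆ G2.domain := inter_subset_left

/-- `cellLT` is `ℚ`-semialgebraic. [folklore] -/
theorem sa_cellLT : IsSemialgebraic ℚ cellLT := G2.isSemialgebraic_domain.inter (isSemialgebraic_lt2 1 0)
/-- `cellGT` is `ℚ`-semialgebraic. [folklore] -/
theorem sa_cellGT : IsSemialgebraic ℚ cellGT := G2.isSemialgebraic_domain.inter (isSemialgebraic_lt2 0 1)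

/-- The restrictions of `Q²` to the two cells. [folklore] -/
def LTrep : KZ.IntegralRep 2 := G2.restrict cellLT sa_cellLT cellLT_sub
/-- The restriction of `Q²` to the cell `{t₁ < t₀}`. [folklore] -/
def GTrep : KZ.IntegralRep 2 := G2.restrict cellGT sa_cellGT cellGT_sub'

/-- `cellGT` lies in the ambient domain. [folklore] -/
theorem cellGT_sub : cellGT ⊆ G2.domain \ cellLT := by
  rintro z ⟨hz, h⟩
  exact ⟨hz, fun hm => lt_asymm h (show z 0 < z 1 from hm.2)⟩

/-- `diag2` is Lebesgue-null. [folklore] -/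
theorem volume_diag2 : volume ((G2.domain \ cellLT) \ cellGT) = 0 := by
  have hsub : (G2.domain \ cellLT) \ cellGT ⊆ {z : Fin 2 → ℝ | z 0 = z 1} := by
    rintro z ⟨⟨hz, n1⟩, n2⟩
    rcases lt_trichotomy (z 0) (z 1) with h | h | h
    · exact absurd ⟨hz, h⟩ n1
    · exact h
    · exact absurd ⟨hz, h⟩ n2
  refine measure_mono_null hsub ?_
  let L : (Fin 2 → ℝ) →ₗ[ℝ] ℝ :=
    LinearMap.proj (R := ℝ) (φ := fun _ : Fin 2 => ℝ) 0 - LinearMap.proj (R := ℝ) (φ := fun _ : Fin 2 => ℝ) 1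
  have hker : {z : Fin 2 → ℝ | z 0 = z 1} = (LinearMap.ker L : Set (Fin 2 → ℝ)) := by
    ext z; simp [L, sub_eq_zero]
  rw [hker]
  refine Measure.addHaar_submodule volume (LinearMap.ker L) ?_
  intro htop
  have hmem : (Pi.single 0 (1 : ℝ) : Fin 2 → ℝ) ∈ LinearMap.ker L := by rw [htop]; trivial
  simp [L] at hmem

/-- The swapped cell is the other cell: `[cell >] ≡ [cell <]`. [folklore] -/
theorem GTrep_sub_LTrep_mem : KZ.of GTrep - KZ.of LTrep ∈ KZ.relations := by
  have h1 := KZ.of_sub_of_reindex_mem_relations GTrep (Equiv.swap (0 : Fin 2) 1)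
  have h2 : KZ.of (GTrep.reindex (Equiv.swap (0 : Fin 2) 1)) - KZ.of LTrep ∈ KZ.relations := by
    refine of_sub_of_mem_relations_of_eqOn ?_ ?_
    · ext w
      simp only [LTrep, GTrep, KZ.IntegralRep.domain_restrict, KZ.IntegralRep.reindex_domain, mem_setOf_eq]
      change w ∈ cellLT ↔ (fun i => w (Equiv.swap (0 : Fin 2) 1 i)) ∈ cellGT
      simp only [cellLT, cellGT, G2_domain, mem_inter_iff, mem_cube2, mem_setOf_eq, Equiv.swap_apply_left,
        Equiv.swap_apply_right]
      tauto
    · intro w _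
      simp only [GTrep, LTrep, KZ.IntegralRep.reindex_integrand, KZ.IntegralRep.integrand_restrict,
        G2_integrand_apply, Equiv.swap_apply_left, Equiv.swap_apply_right]
      ring
  have : KZ.of GTrep - KZ.of LTrep = (KZ.of GTrep - KZ.of (GTrep.reindex (Equiv.swap (0 : Fin 2) 1))) +
      (KZ.of (GTrep.reindex (Equiv.swap (0 : Fin 2) 1)) - KZ.of LTrep) := by abel
  rw [this]
  exact add_mem h1 h2

/-- **`Q² ≡ 2·[cell <]`** modulo relations. [folklore] -/
theorem of_G2_sub_two_LT_mem : KZ.of G2 - 2 • KZ.of LTrep ∈ KZ.relations := by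
  -- peel cellLT, then cellGT, the rest is the null diagonal
  have sa1 : IsSemialgebraic ℚ (G2.domain \ cellLT) := G2.isSemialgebraic_domain.diff sa_cellLT
  have sa2 : IsSemialgebraic ℚ ((G2.domain \ cellLT) \ cellGT) := sa1.diff sa_cellGT
  let R1 : KZ.IntegralRep 2 := G2.restrict (G2.domain \ cellLT) sa1 Set.sdiff_subset
  let R2 : KZ.IntegralRep 2 := G2.restrict ((G2.domain \ cellLT) \ cellGT) sa2
    (Set.sdiff_subset.trans Set.sdiff_subset)
  have p1 : KZ.of G2 - KZ.of LTrep - KZ.of R1 ∈ KZ.relations := by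
    refine KZ.domainAddRel_subset_relations ⟨2, G2, LTrep, R1, ?_, ?_, fun _ _ => rfl, fun _ _ => rfl, rfl⟩
    · change G2.domain = cellLT ∪ (G2.domain \ cellLT)
      rw [Set.union_sdiff_cancel cellLT_sub]
    · change volume (cellLT ∩ (G2.domain \ cellLT)) = 0
      rw [Set.inter_sdiff_self, measure_empty]
  have p2 : KZ.of R1 - KZ.of GTrep - KZ.of R2 ∈ KZ.relations := by
    refine KZ.domainAddRel_subset_relations ⟨2, R1, GTrep, R2, ?_, ?_, fun _ _ => rfl, fun _ _ => rfl, rfl⟩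
    · change G2.domain \ cellLT = cellGT ∪ ((G2.domain \ cellLT) \ cellGT)
      rw [Set.union_sdiff_cancel cellGT_sub]
    · change volume (cellGT ∩ ((G2.domain \ cellLT) \ cellGT)) = 0
      rw [Set.inter_sdiff_self, measure_empty]
  have p3 : KZ.of R2 ∈ KZ.relations :=
    KZ.levelRel_le_relations (KZ.of_mem_levelRel_of_volume_eq_zero _ volume_diag2)
  have p4 := GTrep_sub_LTrep_mem
  have : KZ.of G2 - 2 • KZ.of LTrep =
      (KZ.of G2 - KZ.of LTrep - KZ.of R1) + (KZ.of R1 - KZ.of GTrep - KZ.of R2) + KZ.of R2 +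
        (KZ.of GTrep - KZ.of LTrep) := by
    rw [two_nsmul]; abel
  rw [this]
  exact add_mem (add_mem (add_mem p1 p2) p3) p4

/-! ### The Calabi triangle `P₂ = {t₀ + t₁ + t₀t₁ < 1}` is the cell `{t₀ < t₁}` reflected -/

/-- The Calabi triangle in half-angle coordinates (`u₀ + u₁ < π/2`). [folklore] -/
def tri2 : Set (Fin 2 → ℝ) := G2.domain ∩ {z | z 0 + z 1 + z 0 * z 1 < 1}

/-- `tri2` is `ℚ`-semialgebraic. [folklore] -/
theorem sa_tri2 : IsSemialgebraic ℚ tri2 := by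
  refine G2.isSemialgebraic_domain.inter ?_
  convert Literature.ModelTheory.ExponentialFields.isSemialgebraic_setOf_eval_pos (R := ℝ)
    (1 - (X 0 + X 1 + X 0 * X 1) : MvPolynomial (Fin 2) ℚ) using 1
  ext z; simp [sub_pos]

/-- `[P₂, g ⊗ g]`. [folklore] -/
def Trirep : KZ.IntegralRep 2 := G2.restrict tri2 sa_tri2 inter_subset_left

/-- The reflection on the second coordinate. [folklore] -/
def refl2 (z : Fin 2 → ℝ) : Fin 2 → ℝ := ![z 0, rho (z 1)]

/-- Its derivative `diag(1, ρ'(z₁))`. [folklore] -/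
def refl2Deriv (z : Fin 2 → ℝ) : (Fin 2 → ℝ) →L[ℝ] (Fin 2 → ℝ) :=
  LinearMap.toContinuousLinearMap (Matrix.toLin' !![1, 0; 0, -2 / (1 + z 1) ^ 2])

/-- The determinant of `refl2Deriv`. [folklore] -/
theorem det_refl2Deriv (z : Fin 2 → ℝ) : (refl2Deriv z).det = -2 / (1 + z 1) ^ 2 := by
  have h : (!![1, 0; 0, -2 / (1 + z 1) ^ 2] : Matrix (Fin 2) (Fin 2) ℝ).det = -2 / (1 + z 1) ^ 2 := by
    simp [Matrix.det_fin_two]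
  rw [← h]
  exact LinearMap.det_toLin' _

/-- Differentiability of `refl2` with the stated derivative. [folklore] -/
theorem hasFDerivAt_refl2 {z : Fin 2 → ℝ} (hz : z 1 ≠ -1) : HasFDerivAt refl2 (refl2Deriv z) z := by
  have h0 : HasFDerivAt (fun y : Fin 2 → ℝ => y 0)
      (ContinuousLinearMap.proj (R := ℝ) (φ := fun _ : Fin 2 => ℝ) 0) z := hasFDerivAt_apply 0 z
  have h1 : HasFDerivAt (fun y : Fin 2 → ℝ => y 1)
      (ContinuousLinearMap.proj (R := ℝ) (φ := fun _ : Fin 2 => ℝ) 1) z := hasFDerivAt_apply 1 z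
  have hr : HasFDerivAt (rho ∘ fun y : Fin 2 → ℝ => y 1)
      ((-2 / (1 + z 1) ^ 2) • ContinuousLinearMap.proj (R := ℝ) (φ := fun _ : Fin 2 => ℝ) 1) z :=
    (hasDerivAt_rho hz).comp_hasFDerivAt z h1
  have c0 : HasFDerivAt (fun y : Fin 2 → ℝ => refl2 y 0) ((ContinuousLinearMap.proj 0).comp (refl2Deriv z)) z := by
    refine h0.congr_fderiv ?_
    ext v; simp [refl2Deriv, dotProduct, Fin.sum_univ_two]
  have c1 : HasFDerivAt (fun y : Fin 2 → ℝ => refl2 y 1) ((ContinuousLinearMap.proj 1).comp (refl2Deriv z)) z := by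
    refine hr.congr_fderiv ?_
    ext v; simp [refl2Deriv, dotProduct, Fin.sum_univ_two]
  rw [hasFDerivAt_pi']
  intro i
  fin_cases i
  · exact c0
  · exact c1

/-- Membership in `tri2`, unfolded. [folklore] -/
theorem mem_tri2 {z : Fin 2 → ℝ} :
    z ∈ tri2 ↔ ((0 < z 0 ∧ z 0 < 1) ∧ (0 < z 1 ∧ z 1 < 1)) ∧ z 0 + z 1 + z 0 * z 1 < 1 := by
  rw [tri2, G2_domain]; simp [mem_cube2]

/-- Membership in `cellLT`, unfolded. [folklore] -/
theorem mem_cellLT {z : Fin 2 → ℝ} :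
    z ∈ cellLT ↔ ((0 < z 0 ∧ z 0 < 1) ∧ (0 < z 1 ∧ z 1 < 1)) ∧ z 0 < z 1 := by
  rw [cellLT, G2_domain]; simp [mem_cube2]

/-- Auxiliary lemma `refl2_mem_cellLT` (see the module docstring). [folklore] -/
theorem refl2_mem_cellLT {z : Fin 2 → ℝ} (hz : z ∈ tri2) : refl2 z ∈ cellLT := by
  obtain ⟨⟨⟨a0, a1⟩, ⟨b0, b1⟩⟩, h⟩ := mem_tri2.mp hz
  have hr := rho_mem_Ioo ⟨b0, b1⟩
  rw [mem_cellLT]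
  simp only [refl2, Matrix.cons_val_zero, Matrix.cons_val_one]
  refine ⟨⟨⟨a0, a1⟩, hr⟩, ?_⟩
  rw [rho, lt_div_iff₀ (by linarith)]
  nlinarith

/-- `refl2` is injective on its domain. [folklore] -/
theorem injOn_refl2 : InjOn refl2 tri2 := by
  intro z hz z' hz' h
  obtain ⟨⟨-, ⟨b0, -⟩⟩, -⟩ := mem_tri2.mp hz
  obtain ⟨⟨-, ⟨b0', -⟩⟩, -⟩ := mem_tri2.mp hz'
  have e0 : z 0 = z' 0 := by simpa [refl2] using congrFun h 0
  have e1 : rho (z 1) = rho (z' 1) := by simpa [refl2] using congrFun h 1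
  have e1' : z 1 = z' 1 := by
    have := congrArg rho e1
    rwa [rho_rho (by linarith), rho_rho (by linarith)] at this
  funext i; fin_cases i
  · exact e0
  · exact e1'

/-- The image of the domain under `refl2`. [folklore] -/
theorem image_refl2 : refl2 '' tri2 = cellLT := by
  apply Subset.antisymm
  · rintro _ ⟨z, hz, rfl⟩; exact refl2_mem_cellLT hz
  · intro w hw
    obtain ⟨⟨⟨a0, a1⟩, ⟨b0, b1⟩⟩, h⟩ := mem_cellLT.mp hw
    have hr := rho_mem_Ioo ⟨b0, b1⟩
    refine ⟨![w 0, rho (w 1)], ?_, ?_⟩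
    · rw [mem_tri2]
      simp only [Matrix.cons_val_zero, Matrix.cons_val_one]
      refine ⟨⟨⟨a0, a1⟩, hr⟩, ?_⟩
      have h1 : (1 : ℝ) + w 1 ≠ 0 := by linarith
      have key : w 0 + rho (w 1) + w 0 * rho (w 1) = (2 * w 0 + 1 - w 1) / (1 + w 1) := by
        rw [rho]; field_simp; ring
      rw [key, div_lt_one (by linarith)]
      linarith
    · funext i; fin_cases i
      · simp [refl2]
      · simp [refl2, rho_rho (show w 1 ≠ -1 by linarith)]

/-- `refl2` is a `ℚ`-semialgebraic map on its domain (rational or polynomial components). [folklore] -/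
theorem isSemialgebraicMapOn_refl2 : IsSemialgebraicMapOn ℚ tri2 refl2 := by
  refine IsSemialgebraicMapOn.of_forall sa_tri2 fun j => ?_
  fin_cases j
  · simpa [refl2] using isSemialgebraicFunOn_aeval sa_tri2 (X 0)
  · refine (isSemialgebraicFunOn_aeval_div_aeval sa_tri2 (1 - X 1 : MvPolynomial (Fin 2) ℚ) (1 + X 1)
      fun z hz => ?_).congr fun z _ => ?_
    · obtain ⟨⟨-, ⟨b0, -⟩⟩, -⟩ := mem_tri2.mp hz
      simp only [map_add, map_one, aeval_X]; linarith
    · simp [refl2, rho]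

/-- **The Calabi triangle is the order cell, by ONE change of variables** (the reflection
`u₁ ↦ π/2 − u₁`, i.e. `t₁ ↦ (1−t₁)/(1+t₁)`, under which `2dt/(1+t²)` is invariant). [folklore] -/
theorem Trirep_sub_LTrep_mem_cov : KZ.of Trirep - KZ.of LTrep ∈ KZ.changeOfVariablesRel := by
  refine ⟨2, Trirep, LTrep, refl2, fun z => refl2Deriv z, isSemialgebraicMapOn_refl2,
    fun z hz => (hasFDerivAt_refl2 ?_).hasFDerivWithinAt, injOn_refl2, image_refl2.symm, fun z hz => ?_, rfl⟩
  · obtain ⟨⟨-, ⟨b0, -⟩⟩, -⟩ := mem_tri2.mp hz; linarith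
  · obtain ⟨⟨-, ⟨b0, -⟩⟩, -⟩ := mem_tri2.mp hz
    have hb : (1 : ℝ) + z 1 ≠ 0 := by linarith
    change G2.integrand z = G2.integrand (refl2 z) * |(refl2Deriv z).det|
    rw [det_refl2Deriv, G2_integrand_apply, G2_integrand_apply]
    simp only [refl2, Matrix.cons_val_zero, Matrix.cons_val_one]
    rw [abs_of_neg (by apply div_neg_of_neg_of_pos (by norm_num); positivity), neg_div, neg_neg, mul_assoc,
      gq_rho_mul (by linarith)]

/-- Hence `Q² ≡ 2·[P₂, g ⊗ g]`. [folklore] -/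
theorem of_G2_sub_two_Trirep_mem : KZ.of G2 - 2 • KZ.of Trirep ∈ KZ.relations := by
  have h1 := of_G2_sub_two_LT_mem
  have h2 := KZ.changeOfVariablesRel_subset_relations Trirep_sub_LTrep_mem_cov
  have : KZ.of G2 - 2 • KZ.of Trirep = (KZ.of G2 - 2 • KZ.of LTrep) - 2 • (KZ.of Trirep - KZ.of LTrep) := by
    rw [two_nsmul, two_nsmul]; abel
  rw [this]
  exact sub_mem h1 (KZ.relations.nsmul_mem h2 2)

end Summit.KontsevichZagierPeriods.MzvKernelInKZ.Negative
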